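import Mathlib
import HarnessLib
import Summits.QuantumFields.YangMills.Theses.FemtoCutoffLadder
import Summits.QuantumFields.YangMills.Theorems.FemtoTransferGapBounds
import Summits.QuantumFields.YangMills.Theorems.FemtoCutoffLadderMatchedCouplingExists

/-!
# FemtoCutoffLadder — glue of the nested split of `SubOctaveBounded` (stmt-QuantumFields-25610)

`NestedStepUpper → NestedStepLower → SubOctaveBounded` (route FemtoCutoffLadder, rev 11, split of
stmt-QuantumFields-24085 by seat ym-idea-1 g4, D-0145 LINE «nested reduction»): the incommensurable pair
(L', L), L' ≤ L < 2L', is passed through the COMMON REFINEMENT L·L'.  A matched coupling β'' at size L·L'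
exists at levels ≤ 1/2 (`matchedCouplingExists_proof`); NestedStepUpper at (coarse L, fine L·L', m = L') and
NestedStepLower at (coarse L', fine L·L', m = L) are multiplied and the positive factor
λ₁(L·L')^{LL'}·λ₀(L·L')^{LL'} is cancelled (`topValue_su2Rep_pos`).  Pure real arithmetic. [folklore]
-/

namespace Summit.QuantumFields.YangMills.Theorems.FemtoCutoffLadder

open Summit.QuantumFields.YangMills.Theorems.FemtoTransferGap
open Summit.QuantumFields.YangMills.Theses.FemtoCutoffLadder

/-- **Glue of the nested split** (item stmt-QuantumFields-25610): `NestedStepUpper → NestedStepLower → SubOctaveBounded`,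
through the common refinement `L·L'` and the proved matched-coupling support. [folklore] -/
theorem nestedSplitGlue_proof : NestedSplitGlue := by
  intro hU hLo
  have hM : MatchedCouplingExists := Summit.QuantumFields.YangMills.Theorems.FemtoCutoffLadder.matchedCouplingExists_proof
  obtain ⟨C₁, lam₁, L₁, hlam₁, hU⟩ := hU
  obtain ⟨C₂, lam₂, L₂, hlam₂, hLo⟩ := hLo
  refine ⟨C₁ + C₂, min (min lam₁ lam₂) (1 / 2), max L₁ L₂, ?_, ?_⟩
  · exact lt_min (lt_min hlam₁ hlam₂) (by norm_num)
  intro lam hlam hle L' _ L _ hL0 hL'L hL2 β β' hW hW' hmatch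
  have hle₁ : lam ≤ lam₁ := le_trans hle (le_trans (min_le_left _ _) (min_le_left _ _))
  have hle₂ : lam ≤ lam₂ := le_trans hle (le_trans (min_le_left _ _) (min_le_right _ _))
  have hleh : lam ≤ 1 / 2 := le_trans hle (min_le_right _ _)
  have hL₁ : L₁ ≤ L' := le_trans (le_max_left _ _) hL0
  have hL₂ : L₂ ≤ L' := le_trans (le_max_right _ _) hL0
  -- the common refinement L'' = L * L'
  haveI : NeZero (L * L') := ⟨Nat.mul_ne_zero (NeZero.ne L) (NeZero.ne L')⟩
  obtain ⟨β'', hW'', hmatch''⟩ := hM lam hlam hleh L (L * L') β hW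
  -- Upper step: coarse L, fine L*L' (ratio m = L')
  have h1 := hU lam hlam hle₁ L' L (L * L') (le_trans hL₁ hL'L) (Nat.mul_comm L L') β'' β hW'' hW hmatch''
  -- Lower step: coarse L', fine L*L' (ratio m = L)
  have h2 := hLo lam hlam hle₂ L L' (L * L') hL₂ rfl β'' β' hW'' hW' (hmatch''.trans hmatch)
  -- positivity
  have hb'' : 0 < topValue su2Rep (L * L') β'' ^ (L * L') := pow_pos (topValue_su2Rep_pos _ _) _
  have hb : 0 ≤ topValue su2Rep L β ^ L := pow_nonneg (topValue_su2Rep_pos _ _).le _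
  have hb' : 0 ≤ topValue su2Rep L' β' ^ L' := pow_nonneg (topValue_su2Rep_pos _ _).le _
  have hE₁ : 0 ≤ Real.exp (C₁ * luscherLambda β'' (L * L') ^ 2) := (Real.exp_pos _).le
  set a := secondValue su2Rep L β ^ L
  set b := topValue su2Rep L β ^ L
  set a' := secondValue su2Rep L' β' ^ L'
  set b' := topValue su2Rep L' β' ^ L'
  set a'' := secondValue su2Rep (L * L') β'' ^ (L * L')
  set b'' := topValue su2Rep (L * L') β'' ^ (L * L')
  have hexp : Real.exp (C₁ * luscherLambda β'' (L * L') ^ 2) * Real.exp (C₂ * luscherLambda β'' (L * L') ^ 2)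
      = Real.exp ((C₁ + C₂) * luscherLambda β L ^ 2) := by
    rw [← Real.exp_add, hmatch'']; ring_nf
  -- chain: a * b' * b'' ≤ E₁ a'' b * b' ≤ E₁ b * E₂ a' b''
  have step1 : a * b' * b'' ≤ Real.exp (C₁ * luscherLambda β'' (L * L') ^ 2) * (a'' * b) * b' := by
    have := mul_le_mul_of_nonneg_right h1 hb'
    calc a * b' * b'' = a * b'' * b' := by ring
      _ ≤ _ := this
  have step2 : Real.exp (C₁ * luscherLambda β'' (L * L') ^ 2) * (a'' * b) * b'
      ≤ Real.exp (C₁ * luscherLambda β'' (L * L') ^ 2) * b * (Real.exp (C₂ * luscherLambda β'' (L * L') ^ 2) * (a' * b'')) := by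
    have := mul_le_mul_of_nonneg_left h2 (mul_nonneg hE₁ hb)
    calc Real.exp (C₁ * luscherLambda β'' (L * L') ^ 2) * (a'' * b) * b'
        = Real.exp (C₁ * luscherLambda β'' (L * L') ^ 2) * b * (a'' * b') := by ring
      _ ≤ _ := this
  have key : a * b' * b'' ≤ Real.exp ((C₁ + C₂) * luscherLambda β L ^ 2) * (a' * b) * b'' := by
    calc a * b' * b'' ≤ _ := step1
      _ ≤ _ := step2
      _ = Real.exp ((C₁ + C₂) * luscherLambda β L ^ 2) * (a' * b) * b'' := by rw [← hexp]; ring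
  exact le_of_mul_le_mul_right key hb''


end Summit.QuantumFields.YangMills.Theorems.FemtoCutoffLadder
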